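import Literature.NumberTheory.LFunctions.Zhang2022.DetectorDictForm
import Literature.NumberTheory.LFunctions.Zhang2022.DetectorMainTermFormCS
import Literature.NumberTheory.LFunctions.Zhang2022.MainTermFormCauchySchwarz
import Literature.NumberTheory.LFunctions.Zhang2022.RepairWindowFormDesign

/-!
# Zhang (2022), programme F-S3 (cell landau-siegel §E, row S-E-p6-3 companion): the one-form dictionary
# `Det.DictS` / `Det.DictShift` as ONE Hermitian form — sesquilinear and polar forms, polarisation on `H¹`,
# Cauchy–Schwarz along a line, faithfulness to `FormDetPolar` (one-sided) and to `mainTermFormPolar` (printed)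

Y. Zhang, *Discrete mean estimates and the Landau–Siegel zero*, arXiv:2211.02515v1 [Zhang2022LandauSiegel] —
an unrefereed manuscript under adjudication. **WHAT THIS IS NOT: not a claim about Theorems 1–2 of
arXiv:2211.02515, about Landau–Siegel zeros, or about Parity; nothing here asserts any claim of the manuscript.**
«The programme SEARCHES and TYPES; no claim about Landau–Siegel zeros, Theorems 1–2 of arXiv:2211.02515 or a
repaired Margin232 until a kernel theorem says so.»

Companion (calculus only) of `DetectorDictForm` (ls-Bdet-typer-1: the one-form dictionary «dict_S»
`Det.DictS R W′ c₀ G` = six-moment bulk + three apex terms in `a₁ = G(1⁻)`, `Det.DictShift b` = the shift triple's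
instance; `dictShift_std = mainTermForm` identically; `GluedSides.dictShift_glued_eq_formDetGlued` on non-overlapping
sides). The §E two-sided («glued legs») row S-E-p6-3 (`RepairDetGlued`) needs Cauchy–Schwarz for ONE Hermitian form in
the GLUED profile `G = g₁ + R̃g₂` — the reflection `R̃` is conjugate-linear, so the glued profile is not a complex-linear
function of the pair `(g₁, g₂)` and the one-form currency is the natural one. This file provides, for every recipe
`R`, glue pair `(W′, c₀)`:

* `Det.DictSesq R W′ c₀ u u′ v v′` — the sesquilinear form (linear in `(u,u′)`, conjugate-linear in `(v,v′)`) with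
  `Re DictSesq(G,G) = DictS(G)` (`dictSesq_self_re`), written in the seven profile atoms of `Det.MformDet_eq_moments`
  plus the three apex atoms; `Det.DictPolar := (DictSesq(u,v) + conj DictSesq(v,u))/2` (Hermitian:
  `dictPolar_swap`, `dictPolar_self`); the shift instances `Det.DictShiftSesq`, `Det.DictShiftPolar`;
* sesquilinearity on `H¹` profiles (`dictSesq_add_smul_left/right`) and the **polarisation identity**
  `DictS(u + tf) = DictS(u) + 2Re(t̄·DictPolar(u,f)) + |t|²DictS(f)` (`dictS_add_smul`, `dictShift_add_smul`);
* **Cauchy–Schwarz along a line** (`norm_sq_dictPolar_le_of_line`): if `DictS ≥ 0` at `f` and at every `u + cf`,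
  `c ∈ ℂ`, then `‖DictPolar(u,f)‖² ≤ DictS(u)·DictS(f)` — the discriminant argument, usable on any sub-class closed
  under `u + cf` (the no-overlap glued class of `RepairDetGlued` is one); the slot **`Det.DictShiftPSD b`** (bare `Prop`:
  `DictShift b ≥ 0` on `H¹` profiles of `[0,1]`, NO apex condition — stated, asserted only at `b = (1,2,3)`:
  `dictShiftPSD_std` = `mainTermForm_nonneg_of_isH1`) and Cauchy–Schwarz / «no closing» under it
  (`norm_sq_dictShiftPolar_le_of_psd`, `not_trueNeed_dict_of_psd`, `not_closing_dict_of_psd`);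
* **faithfulness**: on one-sided kinked profiles (`g(1) = h(1) = 0`) `DictPolar R W′ c₀ g h = FormDetPolar R g h`
  (`dictPolar_eq_formDetPolar`: formula I, any glue pair) and at the printed data
  `DictShiftPolar (1,2,3) u v = mainTermFormPolar u v` identically (`dictShiftPolar_std`).

Elementary (integrability bookkeeping on `H¹` and `ring`); no numerics; no new `Prop` facts beyond the displayed slot.
References: arXiv:2211.02515v1 §4 (4.1); Prop. 7.1 with (8.11)–(8.23) [pp. 44–50]; §12 (12.6)–(12.17); Prop. 14.1;
Lemma 15.1; §18 (18.1); §2 (2.18), (2.32)–(2.33). [cite: Zhang2022LandauSiegel, §§2, 4, 7–8, 12, 14–15, 18]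
-/

noncomputable section

open Complex Real ComplexConjugate Set intervalIntegral
open _root_.MeasureTheory

namespace Literature.NumberTheory.LFunctions.Zhang2022

namespace Det

open Repair

variable {R : DetRecipe} {Wp : Fin 3 → ℂ} {c0 : ℂ} {u u' v v' f f' g g' h h' : ℝ → ℂ}

/-! ### The sesquilinear and polar forms of the dictionary -/

/-- **The sesquilinear form of the six-moment bulk** (linear in `(g,g′)`, conjugate-linear in `(h,h′)`): the
right-hand side of `Det.MformDet_eq_moments` read on ARBITRARY profiles —
`(1/π)[m₀⟨g′,h′⟩ − iπm_s⟨g′,h⟩ + iπm_b⟨g,h′⟩ + π²(m_n+m_bs)⟨g,h⟩ − π²m_n g(0)Ī_h + iπ³m_bn(I_gĪ_h − ⟨g,S_h⟩)]`,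
`⟨a,b⟩ = ∫₀¹ab̄`, `I_h = ∫₀¹h`, `S_h(x) = ∫₀ˣh`. [cite: Zhang2022LandauSiegel, Prop 7.1 with (8.11)–(8.23), pp.44–50] -/
def SixMomentSesq (R : DetRecipe) (g g' h h' : ℝ → ℂ) : ℂ :=
  (((1 / π : ℝ)) : ℂ) *
    ((∑ j : Fin 3, R.W j) * (∫ x in (0:ℝ)..1, g' x * conj (h' x))
      - I * π * (∑ j : Fin 3, R.W j * (R.s j : ℂ)) * (∫ x in (0:ℝ)..1, g' x * conj (h x))
      + I * π * (∑ j : Fin 3, R.W j * (R.b j : ℂ)) * (∫ x in (0:ℝ)..1, g x * conj (h' x))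
      + (π : ℂ) ^ 2 * ((∑ j : Fin 3, R.W j * (R.n j : ℂ)) + ∑ j : Fin 3, R.W j * ((R.b j : ℂ) * (R.s j : ℂ)))
          * (∫ x in (0:ℝ)..1, g x * conj (h x))
      - (π : ℂ) ^ 2 * (∑ j : Fin 3, R.W j * (R.n j : ℂ)) * (g 0 * conj (∫ x in (0:ℝ)..1, h x))
      + I * (π : ℂ) ^ 3 * (∑ j : Fin 3, R.W j * ((R.b j : ℂ) * (R.n j : ℂ)))
          * ((∫ x in (0:ℝ)..1, g x) * conj (∫ x in (0:ℝ)..1, h x)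
              - ∫ x in (0:ℝ)..1, g x * conj (∫ t in (0:ℝ)..x, h t)))

/-- On a one-sided kinked first argument `M_R(g,h)` IS the six-moment sesquilinear expression
(`Det.MformDet_eq_moments`, renamed). [cite: Zhang2022LandauSiegel, Prop 7.1 with (8.11)–(8.23), pp.44–50] -/
theorem MformDet_eq_sixMomentSesq (hg : KinkedProfile g g') (hh : KinkedProfile h h') (hg1 : g 1 = 0) :
    MformDet R g g' h h' = SixMomentSesq R g g' h h' :=
  MformDet_eq_moments hg hh hg1

/-- `SixMoment_R(g) = 2 Re SixMomentSesq_R(g,g)` for EVERY profile (same six terms).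
[cite: Zhang2022LandauSiegel, Prop 7.1 with (8.11)–(8.23), pp.44–50] -/
theorem sixMomentS_eq_two_re (R : DetRecipe) (g g' : ℝ → ℂ) :
    SixMomentS R g g' = 2 * (SixMomentSesq R g g' g g').re := by
  rw [SixMomentS, SixMomentSesq, intervalIntegral_mul_conj_self g', intervalIntegral_mul_conj_self g]
  set m0 : ℂ := ∑ j : Fin 3, R.W j
  set ms : ℂ := ∑ j : Fin 3, R.W j * (R.s j : ℂ)
  set mn : ℂ := ∑ j : Fin 3, R.W j * (R.n j : ℂ)
  set mb : ℂ := ∑ j : Fin 3, R.W j * (R.b j : ℂ)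
  set mbs : ℂ := ∑ j : Fin 3, R.W j * ((R.b j : ℂ) * (R.s j : ℂ))
  set mbn : ℂ := ∑ j : Fin 3, R.W j * ((R.b j : ℂ) * (R.n j : ℂ))
  set A1 : ℝ := ∫ x in (0:ℝ)..1, ‖g' x‖ ^ 2
  set A2 : ℂ := ∫ x in (0:ℝ)..1, g' x * conj (g x)
  set A4 : ℂ := ∫ x in (0:ℝ)..1, g x * conj (g' x)
  set A5 : ℝ := ∫ x in (0:ℝ)..1, ‖g x‖ ^ 2
  set B0 : ℂ := g 0 * conj (∫ x in (0:ℝ)..1, g x)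
  set T7 : ℂ := (∫ x in (0:ℝ)..1, g x) * conj (∫ x in (0:ℝ)..1, g x)
    - ∫ x in (0:ℝ)..1, g x * conj (∫ t in (0:ℝ)..x, g t)
  have hπ : (π : ℝ) ≠ 0 := Real.pi_ne_zero
  simp only [Complex.mul_re, Complex.mul_im, Complex.add_re, Complex.add_im, Complex.sub_re, Complex.sub_im,
    Complex.ofReal_re, Complex.ofReal_im, Complex.I_re, Complex.I_im]
  simp only [← Complex.ofReal_pow, Complex.ofReal_re, Complex.ofReal_im]
  field_simp
  ring

/-- **The sesquilinear form of the dictionary:** `DictSesq = 2·SixMomentSesq(g,h) − 2π·conj(m_n)·g(1)·Ī_h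
− 2i(ΣW′ + c₀)·g(0)·conj h(1) + 2Im(m_b − m_s)·g(1)·conj h(1)` (the three apex atoms made sesquilinear).
[cite: Zhang2022LandauSiegel, §4 (4.1); Prop 14.1; Lemma 15.1; §18 (18.1)] -/
def DictSesq (R : DetRecipe) (Wp : Fin 3 → ℂ) (c0 : ℂ) (g g' h h' : ℝ → ℂ) : ℂ :=
  2 * SixMomentSesq R g g' h h'
    - 2 * π * (conj (∑ j : Fin 3, R.W j * (R.n j : ℂ)) * g 1 * conj (∫ x in (0:ℝ)..1, h x))
    + 2 * (-I * ((∑ j : Fin 3, Wp j) + c0) * g 0 * conj (h 1))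
    + 2 * ((((∑ j : Fin 3, R.W j * (R.b j : ℂ)) - ∑ j : Fin 3, R.W j * (R.s j : ℂ)).im : ℝ) : ℂ)
        * (g 1 * conj (h 1))

/-- `Re DictSesq(G,G) = DictS(G)` for every profile. [cite: Zhang2022LandauSiegel, §4 (4.1); §18 (18.1)] -/
theorem dictSesq_self_re (R : DetRecipe) (Wp : Fin 3 → ℂ) (c0 : ℂ) (g g' : ℝ → ℂ) :
    (DictSesq R Wp c0 g g' g g').re = DictS R Wp c0 g g' := by
  rw [DictS, sixMomentS_eq_two_re, DictSesq]
  have h1 : g 1 * conj (g 1) = ((‖g 1‖ ^ 2 : ℝ) : ℂ) := by rw [Complex.mul_conj']; push_cast; rfl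
  rw [h1]
  simp only [Complex.add_re, Complex.sub_re, Complex.mul_re, Complex.mul_im, Complex.ofReal_re,
    Complex.ofReal_im, Complex.re_ofNat, Complex.im_ofNat]
  ring

/-- **The polar (Hermitian) form of the dictionary:** `DictPolar(u,v) = (DictSesq(u,v) + conj DictSesq(v,u))/2`.
[cite: Zhang2022LandauSiegel, §4 (4.1); §18 (18.1)] -/
def DictPolar (R : DetRecipe) (Wp : Fin 3 → ℂ) (c0 : ℂ) (u u' v v' : ℝ → ℂ) : ℂ :=
  (DictSesq R Wp c0 u u' v v' + conj (DictSesq R Wp c0 v v' u u')) / 2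

/-- Hermitian symmetry `DictPolar(v,u) = conj DictPolar(u,v)`. [cite: Zhang2022LandauSiegel, §4 (4.1)] -/
theorem dictPolar_swap (R : DetRecipe) (Wp : Fin 3 → ℂ) (c0 : ℂ) (u u' v v' : ℝ → ℂ) :
    DictPolar R Wp c0 v v' u u' = conj (DictPolar R Wp c0 u u' v v') := by
  simp only [DictPolar, map_div₀, map_add, Complex.conj_conj, Complex.conj_ofNat, add_comm]

/-- `DictPolar(g,g) = DictS(g)` (as a complex number). [cite: Zhang2022LandauSiegel, §4 (4.1)] -/
theorem dictPolar_self (R : DetRecipe) (Wp : Fin 3 → ℂ) (c0 : ℂ) (g g' : ℝ → ℂ) :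
    DictPolar R Wp c0 g g' g g' = (DictS R Wp c0 g g' : ℂ) := by
  rw [DictPolar, ← dictSesq_self_re, Complex.add_conj]
  push_cast
  ring

/-- `Im DictPolar(g,g) = 0`. [cite: Zhang2022LandauSiegel, §4 (4.1)] -/
theorem dictPolar_self_im (R : DetRecipe) (Wp : Fin 3 → ℂ) (c0 : ℂ) (g g' : ℝ → ℂ) :
    (DictPolar R Wp c0 g g' g g').im = 0 := by
  rw [dictPolar_self, Complex.ofReal_im]

/-! ### The shift instances and the displayed slot -/

/-- The sesquilinear form of the shift dictionary `Det.DictShift b` (glue pair `(W·n/b, −e^{iπΣb/2})`).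
[cite: Zhang2022LandauSiegel, §4 (4.1); Prop 14.1; Lemma 15.1; §18 (18.1)] -/
def DictShiftSesq (b : Fin 3 → ℝ) (u u' v v' : ℝ → ℂ) : ℂ :=
  DictSesq (shiftRecipe b) (shiftGlueW b) (shiftGlue0 b) u u' v v'

/-- **The polar form `P^dict_b(u,v)` of the shift dictionary** — the cross functional of the glued currency.
[cite: Zhang2022LandauSiegel, §4 (4.1); §18 (18.1); §2 (2.18)] -/
def DictShiftPolar (b : Fin 3 → ℝ) (u u' v v' : ℝ → ℂ) : ℂ :=
  DictPolar (shiftRecipe b) (shiftGlueW b) (shiftGlue0 b) u u' v v'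

/-- `DictShiftPolar` unfolded to `DictPolar`. [cite: Zhang2022LandauSiegel, §4 (4.1)] -/
theorem dictShiftPolar_eq (b : Fin 3 → ℝ) (u u' v v' : ℝ → ℂ) :
    DictShiftPolar b u u' v v' = DictPolar (shiftRecipe b) (shiftGlueW b) (shiftGlue0 b) u u' v v' := rfl

/-- Hermitian symmetry of `DictShiftPolar`. [cite: Zhang2022LandauSiegel, §4 (4.1)] -/
theorem dictShiftPolar_swap (b : Fin 3 → ℝ) (u u' v v' : ℝ → ℂ) :
    DictShiftPolar b v v' u u' = conj (DictShiftPolar b u u' v v') :=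
  dictPolar_swap _ _ _ _ _ _ _

/-- `DictShiftPolar(g,g) = DictShift(g)`. [cite: Zhang2022LandauSiegel, §4 (4.1)] -/
theorem dictShiftPolar_self (b : Fin 3 → ℝ) (g g' : ℝ → ℂ) :
    DictShiftPolar b g g' g g' = (DictShift b g g' : ℂ) :=
  dictPolar_self _ _ _ _ _

/-- **E*-S (i), two-sided shape — the shift dictionary PSD on `H¹` profiles of `[0,1]`** (NO apex condition: glued,
overlapping and one-sided profiles alike): `0 ≤ DictShift b G G′` for every `G ∈ H¹(0,1)`. Bare `Prop`, the slot the
§E glued row displays; asserted here ONLY at `b = (1,2,3)` (`dictShiftPSD_std`). For sign-admissible `b` it is the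
cell's two-sided doubling / circle-Parseval statement (identity level, two lineages) — NOT claimed.
[cite: Zhang2022LandauSiegel, §4 (4.1); §2 (2.18)–(2.19)] -/
def DictShiftPSD (b : Fin 3 → ℝ) : Prop :=
  ∀ G G' : ℝ → ℂ, IsH1OnUnitInterval G G' → 0 ≤ DictShift b G G'

/-- **The printed instance is a theorem:** `DictShiftPSD (1,2,3)` (`dictShift_std` + `mainTermForm_nonneg_of_isH1`).
[cite: Zhang2022LandauSiegel, §4 (4.1); §2 (2.18)–(2.19)] -/
theorem dictShiftPSD_std : DictShiftPSD ![1, 2, 3] := fun G G' hG => by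
  rw [dictShift_std]; exact mainTermForm_nonneg_of_isH1 hG

/-- Under the slot, one-sided kinked profiles give back the E-010 slot `FormDetPSD (shiftRecipe b)`
(`dictShift_eq_formDet`). [cite: Zhang2022LandauSiegel, Prop 7.1 p.44, (7.2)] -/
theorem DictShiftPSD.formDetPSD {b : Fin 3 → ℝ} (h : DictShiftPSD b) : FormDetPSD (shiftRecipe b) :=
  fun g g' hg hg1 => by rw [← dictShift_eq_formDet b hg hg1]; exact h g g' hg.isH1

/-! ### Integrability bookkeeping on `H¹` (the atoms not already in `MainTermFormCauchySchwarz`) -/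

/-- `∫₀¹(u + tf) = ∫₀¹u + t∫₀¹f`. [folklore] -/
private theorem integral_add_smul_unit (hu : IsH1OnUnitInterval u u') (hf : IsH1OnUnitInterval f f') (t : ℂ) :
    (∫ s in (0:ℝ)..1, (u s + t * f s)) = (∫ s in (0:ℝ)..1, u s) + t * ∫ s in (0:ℝ)..1, f s :=
  hu.primitive_add_smul hf t (right_mem_Icc.2 zero_le_one)

/-! ### Sesquilinearity of `SixMomentSesq` and `DictSesq` on `H¹` -/

/-- Linearity of `SixMomentSesq` in the first argument. [cite: Zhang2022LandauSiegel, Prop 7.1 pp.44–50] -/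
theorem sixMomentSesq_add_smul_left (hu : IsH1OnUnitInterval u u') (hf : IsH1OnUnitInterval f f')
    (hv : IsH1OnUnitInterval v v') (t : ℂ) :
    SixMomentSesq R (fun x => u x + t * f x) (fun x => u' x + t * f' x) v v'
      = SixMomentSesq R u u' v v' + t * SixMomentSesq R f f' v v' := by
  have e1 : (∫ x in (0:ℝ)..1, (u' x + t * f' x) * conj (v' x))
      = (∫ x in (0:ℝ)..1, u' x * conj (v' x)) + t * ∫ x in (0:ℝ)..1, f' x * conj (v' x) := by
    rw [← intervalIntegral.integral_const_mul, ← intervalIntegral.integral_add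
      (hu.intervalIntegrable_deriv_mul_conj_deriv hv)
      ((hf.intervalIntegrable_deriv_mul_conj_deriv hv).const_mul t)]
    exact intervalIntegral.integral_congr fun x _ => by ring
  have e2 : (∫ x in (0:ℝ)..1, (u' x + t * f' x) * conj (v x))
      = (∫ x in (0:ℝ)..1, u' x * conj (v x)) + t * ∫ x in (0:ℝ)..1, f' x * conj (v x) := by
    rw [← intervalIntegral.integral_const_mul, ← intervalIntegral.integral_add
      (hu.intervalIntegrable_deriv_mul_conj hv)
      ((hf.intervalIntegrable_deriv_mul_conj hv).const_mul t)]
    exact intervalIntegral.integral_congr fun x _ => by ring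
  have e3 : (∫ x in (0:ℝ)..1, (u x + t * f x) * conj (v' x))
      = (∫ x in (0:ℝ)..1, u x * conj (v' x)) + t * ∫ x in (0:ℝ)..1, f x * conj (v' x) := by
    rw [← intervalIntegral.integral_const_mul, ← intervalIntegral.integral_add
      (intervalIntegrable_mul_conj_deriv' hu hv)
      ((intervalIntegrable_mul_conj_deriv' hf hv).const_mul t)]
    exact intervalIntegral.integral_congr fun x _ => by ring
  have e4 : (∫ x in (0:ℝ)..1, (u x + t * f x) * conj (v x))
      = (∫ x in (0:ℝ)..1, u x * conj (v x)) + t * ∫ x in (0:ℝ)..1, f x * conj (v x) := by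
    rw [← intervalIntegral.integral_const_mul, ← intervalIntegral.integral_add
      (hu.intervalIntegrable_mul_conj hv) ((hf.intervalIntegrable_mul_conj hv).const_mul t)]
    exact intervalIntegral.integral_congr fun x _ => by ring
  have e5 : (∫ x in (0:ℝ)..1, (u x + t * f x) * conj (∫ s in (0:ℝ)..x, v s))
      = (∫ x in (0:ℝ)..1, u x * conj (∫ s in (0:ℝ)..x, v s))
        + t * ∫ x in (0:ℝ)..1, f x * conj (∫ s in (0:ℝ)..x, v s) := by
    rw [← intervalIntegral.integral_const_mul, ← intervalIntegral.integral_add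
      (hu.intervalIntegrable_mul_conj_primitive hv)
      ((hf.intervalIntegrable_mul_conj_primitive hv).const_mul t)]
    exact intervalIntegral.integral_congr fun x _ => by ring
  simp only [SixMomentSesq]
  rw [e1, e2, e3, e4, e5, integral_add_smul_unit hu hf t]
  ring

/-- Conjugate-linearity of `SixMomentSesq` in the second argument. [cite: Zhang2022LandauSiegel, Prop 7.1 pp.44–50] -/
theorem sixMomentSesq_add_smul_right (hu : IsH1OnUnitInterval u u') (hv : IsH1OnUnitInterval v v')
    (hf : IsH1OnUnitInterval f f') (t : ℂ) :
    SixMomentSesq R u u' (fun x => v x + t * f x) (fun x => v' x + t * f' x)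
      = SixMomentSesq R u u' v v' + conj t * SixMomentSesq R u u' f f' := by
  have e1 : (∫ x in (0:ℝ)..1, u' x * conj (v' x + t * f' x))
      = (∫ x in (0:ℝ)..1, u' x * conj (v' x)) + conj t * ∫ x in (0:ℝ)..1, u' x * conj (f' x) := by
    rw [← intervalIntegral.integral_const_mul, ← intervalIntegral.integral_add
      (hu.intervalIntegrable_deriv_mul_conj_deriv hv)
      ((hu.intervalIntegrable_deriv_mul_conj_deriv hf).const_mul (conj t))]
    exact intervalIntegral.integral_congr fun x _ => by simp only [map_add, map_mul]; ring
  have e2 : (∫ x in (0:ℝ)..1, u' x * conj (v x + t * f x))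
      = (∫ x in (0:ℝ)..1, u' x * conj (v x)) + conj t * ∫ x in (0:ℝ)..1, u' x * conj (f x) := by
    rw [← intervalIntegral.integral_const_mul, ← intervalIntegral.integral_add
      (hu.intervalIntegrable_deriv_mul_conj hv)
      ((hu.intervalIntegrable_deriv_mul_conj hf).const_mul (conj t))]
    exact intervalIntegral.integral_congr fun x _ => by simp only [map_add, map_mul]; ring
  have e3 : (∫ x in (0:ℝ)..1, u x * conj (v' x + t * f' x))
      = (∫ x in (0:ℝ)..1, u x * conj (v' x)) + conj t * ∫ x in (0:ℝ)..1, u x * conj (f' x) := by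
    rw [← intervalIntegral.integral_const_mul, ← intervalIntegral.integral_add
      (intervalIntegrable_mul_conj_deriv' hu hv)
      ((intervalIntegrable_mul_conj_deriv' hu hf).const_mul (conj t))]
    exact intervalIntegral.integral_congr fun x _ => by simp only [map_add, map_mul]; ring
  have e4 : (∫ x in (0:ℝ)..1, u x * conj (v x + t * f x))
      = (∫ x in (0:ℝ)..1, u x * conj (v x)) + conj t * ∫ x in (0:ℝ)..1, u x * conj (f x) := by
    rw [← intervalIntegral.integral_const_mul, ← intervalIntegral.integral_add
      (hu.intervalIntegrable_mul_conj hv) ((hu.intervalIntegrable_mul_conj hf).const_mul (conj t))]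
    exact intervalIntegral.integral_congr fun x _ => by simp only [map_add, map_mul]; ring
  have e5 : (∫ x in (0:ℝ)..1, u x * conj (∫ s in (0:ℝ)..x, (v s + t * f s)))
      = (∫ x in (0:ℝ)..1, u x * conj (∫ s in (0:ℝ)..x, v s))
        + conj t * ∫ x in (0:ℝ)..1, u x * conj (∫ s in (0:ℝ)..x, f s) := by
    rw [← intervalIntegral.integral_const_mul, ← intervalIntegral.integral_add
      (hu.intervalIntegrable_mul_conj_primitive hv)
      ((hu.intervalIntegrable_mul_conj_primitive hf).const_mul (conj t))]
    refine intervalIntegral.integral_congr fun x hx => ?_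
    rw [uIcc_of_le zero_le_one] at hx
    simp only [hv.primitive_add_smul hf t hx, map_add, map_mul]
    ring
  simp only [SixMomentSesq]
  rw [e1, e2, e3, e4, e5, integral_add_smul_unit hv hf t]
  simp only [map_add, map_mul]
  ring

/-- Linearity of `DictSesq` in the first argument. [cite: Zhang2022LandauSiegel, §4 (4.1); §18 (18.1)] -/
theorem dictSesq_add_smul_left (hu : IsH1OnUnitInterval u u') (hf : IsH1OnUnitInterval f f')
    (hv : IsH1OnUnitInterval v v') (t : ℂ) :
    DictSesq R Wp c0 (fun x => u x + t * f x) (fun x => u' x + t * f' x) v v'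
      = DictSesq R Wp c0 u u' v v' + t * DictSesq R Wp c0 f f' v v' := by
  simp only [DictSesq, sixMomentSesq_add_smul_left hu hf hv t]
  ring

/-- Conjugate-linearity of `DictSesq` in the second argument. [cite: Zhang2022LandauSiegel, §4 (4.1); §18 (18.1)] -/
theorem dictSesq_add_smul_right (hu : IsH1OnUnitInterval u u') (hv : IsH1OnUnitInterval v v')
    (hf : IsH1OnUnitInterval f f') (t : ℂ) :
    DictSesq R Wp c0 u u' (fun x => v x + t * f x) (fun x => v' x + t * f' x)
      = DictSesq R Wp c0 u u' v v' + conj t * DictSesq R Wp c0 u u' f f' := by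
  simp only [DictSesq, sixMomentSesq_add_smul_right hu hv hf t, integral_add_smul_unit hv hf t,
    map_add, map_mul]
  ring

/-! ### Polarisation identity and Cauchy–Schwarz along a line -/

/-- **Polarisation identity for the dictionary** on `H¹` profiles:
`DictS(u + tf) = DictS(u) + 2Re(conj t · DictPolar(u,f)) + ‖t‖²·DictS(f)`.
[cite: Zhang2022LandauSiegel, §4 (4.1); §2 (2.18)] -/
theorem dictS_add_smul (hu : IsH1OnUnitInterval u u') (hf : IsH1OnUnitInterval f f') (t : ℂ) :
    DictS R Wp c0 (fun x => u x + t * f x) (fun x => u' x + t * f' x)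
      = DictS R Wp c0 u u' + 2 * (conj t * DictPolar R Wp c0 u u' f f').re + ‖t‖ ^ 2 * DictS R Wp c0 f f' := by
  have huf := hu.add_smul hf t
  rw [← dictSesq_self_re, ← dictSesq_self_re R Wp c0 u u', ← dictSesq_self_re R Wp c0 f f',
    dictSesq_add_smul_left hu hf huf t, dictSesq_add_smul_right hu hu hf t,
    dictSesq_add_smul_right hf hu hf t, DictPolar]
  have ht : t * conj t = ((‖t‖ ^ 2 : ℝ) : ℂ) := by rw [Complex.mul_conj']; push_cast; rfl
  have key : (DictSesq R Wp c0 u u' u u' + conj t * DictSesq R Wp c0 u u' f f'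
        + t * (DictSesq R Wp c0 f f' u u' + conj t * DictSesq R Wp c0 f f' f f')).re
      = (DictSesq R Wp c0 u u' u u').re
        + (conj t * DictSesq R Wp c0 u u' f f' + t * DictSesq R Wp c0 f f' u u').re
        + (((‖t‖ ^ 2 : ℝ) : ℂ) * DictSesq R Wp c0 f f' f f').re := by
    rw [← ht]; simp only [Complex.add_re, mul_add, ← mul_assoc]; ring
  rw [key, re_cross_eq_two_re_polar, Complex.re_ofReal_mul]

/-- The shift instance of the polarisation identity. [cite: Zhang2022LandauSiegel, §4 (4.1); §2 (2.18)] -/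
theorem dictShift_add_smul {b : Fin 3 → ℝ} (hu : IsH1OnUnitInterval u u') (hf : IsH1OnUnitInterval f f')
    (t : ℂ) :
    DictShift b (fun x => u x + t * f x) (fun x => u' x + t * f' x)
      = DictShift b u u' + 2 * (conj t * DictShiftPolar b u u' f f').re + ‖t‖ ^ 2 * DictShift b f f' :=
  dictS_add_smul hu hf t

/-- **Cauchy–Schwarz along a line (discriminant argument):** if the dictionary is non-negative at `f` and at every
`u + c·f`, `c ∈ ℂ` (e.g. on any class closed under these combinations on which it is PSD), then
`‖DictPolar(u,f)‖² ≤ DictS(u)·DictS(f)`. [cite: Zhang2022LandauSiegel, §2 (2.18)–(2.19), (2.32)–(2.33)] -/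
theorem norm_sq_dictPolar_le_of_line (hu : IsH1OnUnitInterval u u') (hf : IsH1OnUnitInterval f f')
    (hline : ∀ c : ℂ, 0 ≤ DictS R Wp c0 (fun x => u x + c * f x) (fun x => u' x + c * f' x))
    (hQf : 0 ≤ DictS R Wp c0 f f') :
    ‖DictPolar R Wp c0 u u' f f'‖ ^ 2 ≤ DictS R Wp c0 u u' * DictS R Wp c0 f f' := by
  set P := DictPolar R Wp c0 u u' f f' with hP
  have hQu : 0 ≤ DictS R Wp c0 u u' := by simpa using hline 0
  have hquad : ∀ r : ℝ, 0 ≤ (‖P‖ ^ 2 * DictS R Wp c0 f f') * (r * r) + (-(2 * ‖P‖ ^ 2)) * r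
      + DictS R Wp c0 u u' := by
    intro r
    have h := hline (-(r : ℂ) * P)
    rw [dictS_add_smul hu hf] at h
    have h1 : (conj (-(r : ℂ) * P) * P).re = -(r * ‖P‖ ^ 2) := by
      have e : conj (-(r : ℂ) * P) * P = -((r * ‖P‖ ^ 2 : ℝ) : ℂ) := by
        rw [map_mul, map_neg, Complex.conj_ofReal, mul_assoc, Complex.conj_mul']
        push_cast; ring
      rw [e, Complex.neg_re, Complex.ofReal_re]
    have h2 : ‖-(r : ℂ) * P‖ ^ 2 = r ^ 2 * ‖P‖ ^ 2 := by
      rw [norm_mul, norm_neg, Complex.norm_real, mul_pow, Real.norm_eq_abs, sq_abs]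
    rw [h1, h2] at h
    nlinarith [h]
  have hdisc := discrim_le_zero hquad
  rw [discrim] at hdisc
  by_cases hP0 : ‖P‖ ^ 2 = 0
  · rw [hP0]; exact mul_nonneg hQu hQf
  · have hpos : 0 < ‖P‖ ^ 2 := lt_of_le_of_ne (sq_nonneg _) (Ne.symm hP0)
    have h3 : ‖P‖ ^ 2 * ‖P‖ ^ 2 ≤ ‖P‖ ^ 2 * (DictS R Wp c0 u u' * DictS R Wp c0 f f') := by
      nlinarith [hdisc]
    exact le_of_mul_le_mul_left h3 hpos

/-- **PSD ⇒ exact Cauchy–Schwarz for the shift dictionary on `H¹`:** under `DictShiftPSD b`,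
`‖P^dict_b(u,f)‖² ≤ DictShift_b(u)·DictShift_b(f)` for all `H¹` profiles (glued, overlapping, one-sided alike).
[cite: Zhang2022LandauSiegel, §2 (2.18)–(2.19), (2.32)–(2.33); §4 (4.1)] -/
theorem norm_sq_dictShiftPolar_le_of_psd {b : Fin 3 → ℝ} (hb : DictShiftPSD b) (hu : IsH1OnUnitInterval u u')
    (hf : IsH1OnUnitInterval f f') :
    ‖DictShiftPolar b u u' f f'‖ ^ 2 ≤ DictShift b u u' * DictShift b f f' :=
  norm_sq_dictPolar_le_of_line hu hf (fun c => hb _ _ (hu.add_smul hf c)) (hb f f' hf)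

/-- **«T-true» never holds in the glued currency under the slot:** `¬ (DictShift_b(G)·DictShift_b(f) <
‖P^dict_b(G,f)‖²)` for `H¹` legs — the shape of `Repair.not_repairable_true_need` (`C₂₃₂·C₂₃₃ < ‖dSum‖²`).
[cite: Zhang2022LandauSiegel, §2 (2.18)–(2.19), (2.32)–(2.34)] -/
theorem not_trueNeed_dict_of_psd {b : Fin 3 → ℝ} (hb : DictShiftPSD b) (hg : IsH1OnUnitInterval g g')
    (hf : IsH1OnUnitInterval f f') :
    ¬ (DictShift b g g' * DictShift b f f' < ‖DictShiftPolar b g g' f f'‖ ^ 2) :=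
  not_lt.2 (norm_sq_dictShiftPolar_le_of_psd hb hg hf)

/-- **Thresholds of polar provenance never close the §2 final step in the glued currency, under the slot:** if
`DictShift_b(G) ≤ q`, `DictShift_b(f) ≤ c_J` and `d ≤ ‖P^dict_b(G,f)‖` then `¬ (√(q·c_J) < d)`.
[cite: Zhang2022LandauSiegel, §2 (2.18), Props 2.4–2.6 p.6, (2.32)–(2.33)] -/
theorem not_closing_dict_of_psd {b : Fin 3 → ℝ} (hb : DictShiftPSD b) (hg : IsH1OnUnitInterval g g')
    (hf : IsH1OnUnitInterval f f') {q cJ d : ℝ} (hq : DictShift b g g' ≤ q) (hcJ : DictShift b f f' ≤ cJ)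
    (hd : d ≤ ‖DictShiftPolar b g g' f f'‖) : ¬ (Real.sqrt (q * cJ) < d) := by
  refine not_lt.2 (hd.trans ?_)
  rw [← Real.sqrt_sq (norm_nonneg (DictShiftPolar b g g' f f'))]
  refine Real.sqrt_le_sqrt ((norm_sq_dictShiftPolar_le_of_psd hb hg hf).trans ?_)
  exact mul_le_mul hq hcJ (hb f f' hf) ((hb g g' hg).trans hq)

/-! ### Faithfulness: one-sided legs (formula I) and the printed triple ((4.1)) -/

/-- `conj ∫₀¹ v′·conj u = ∫₀¹ u·conj v′` (swap atom). [folklore] -/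
private theorem conj_integral_mul_conj (a c : ℝ → ℂ) :
    conj (∫ x in (0:ℝ)..1, a x * conj (c x)) = ∫ x in (0:ℝ)..1, c x * conj (a x) := by
  have : conj (∫ x in (0:ℝ)..1, a x * conj (c x)) = ∫ x in (0:ℝ)..1, conj (a x * conj (c x)) := by
    simp only [intervalIntegral, map_sub, integral_conj]
  rw [this]
  exact intervalIntegral.integral_congr fun x _ => by simp [mul_comm]

/-- **On one-sided kinked legs the dictionary's polar form IS formula I's polar form**, whatever the glue pair:
`DictPolar R W′ c₀ g h = FormDetPolar R g h` for `g(1) = h(1) = 0` (the apex atoms vanish; `M_R = SixMomentSesq`).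
So the one-sided row 17 (`Repair.familyDetShift`) embeds in the glued currency verdict for verdict.
[cite: Zhang2022LandauSiegel, Prop 7.1 with (8.11)–(8.23), pp.44–50] -/
theorem dictPolar_eq_formDetPolar (Wp : Fin 3 → ℂ) (c0 : ℂ) (hg : KinkedProfile g g') (hh : KinkedProfile h h')
    (hg1 : g 1 = 0) (hh1 : h 1 = 0) :
    DictPolar R Wp c0 g g' h h' = FormDetPolar R g g' h h' := by
  rw [DictPolar, FormDetPolar, MformDet_eq_sixMomentSesq hg hh hg1, MformDet_eq_sixMomentSesq hh hg hh1,
    DictSesq, DictSesq, hg1, hh1]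
  simp only [map_zero, mul_zero, zero_mul, sub_zero, add_zero, map_mul, Complex.conj_ofNat]
  ring

/-- Shift instance: `DictShiftPolar b g h = FormDetPolar (shiftRecipe b) g h` on one-sided kinked legs.
[cite: Zhang2022LandauSiegel, Prop 7.1 with (8.11)–(8.23), pp.44–50] -/
theorem dictShiftPolar_eq_formDetPolar (b : Fin 3 → ℝ) (hg : KinkedProfile g g') (hh : KinkedProfile h h')
    (hg1 : g 1 = 0) (hh1 : h 1 = 0) :
    DictShiftPolar b g g' h h' = FormDetPolar (shiftRecipe b) g g' h h' :=
  dictPolar_eq_formDetPolar _ _ hg hh hg1 hh1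

/-- **At the printed data the dictionary's polar form is (4.1)'s polar form, identically in the profiles:**
`DictPolar zhangRecipe (3,3,1) 1 u v = mainTermFormPolar u v` (moments `(4,15,12,9,32,24)`, `ΣW′ + c₀ = 8`).
[cite: Zhang2022LandauSiegel, §4 (4.1); §18 (18.1)] -/
theorem dictPolar_zhang (u u' v v' : ℝ → ℂ) :
    DictPolar zhangRecipe zhangGlueW 1 u u' v v' = mainTermFormPolar u u' v v' := by
  obtain ⟨h0, hs, hn, hb, hbs, hbn⟩ := moments_zhang
  rw [DictPolar, mainTermFormPolar, DictSesq, DictSesq, SixMomentSesq, SixMomentSesq, h0, hs, hn, hb, hbs, hbn,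
    sum_zhangGlueW, mainTermFormSesq, mainTermFormSesq]
  simp only [map_add, map_sub, map_mul, map_neg, Complex.conj_conj, Complex.conj_ofReal, Complex.conj_I,
    Complex.conj_ofNat, map_one, map_pow, conj_integral_mul_conj]
  have hπ : (π : ℂ) ≠ 0 := Complex.ofReal_ne_zero.2 Real.pi_ne_zero
  norm_num
  field_simp
  ring

/-- **Shift instance at the printed triple:** `DictShiftPolar (1,2,3) u v = mainTermFormPolar u v` identically — so
the glued row's cross functional at `b = (1,2,3)` is the manuscript's `P` (and on the design legs `P(𝔤_θ, f_θ) = 𝔡 + 𝔡′`,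
`Repair.dSumS_eq_polar`). [cite: Zhang2022LandauSiegel, §4 (4.1); §18 (18.1); §10 (10.1)] -/
theorem dictShiftPolar_std (u u' v v' : ℝ → ℂ) :
    DictShiftPolar ![1, 2, 3] u u' v v' = mainTermFormPolar u u' v v' := by
  rw [DictShiftPolar, shiftRecipe_std, shiftGlueW_std, shiftGlue0_std, dictPolar_zhang]

end Det

end Literature.NumberTheory.LFunctions.Zhang2022
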